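/-
Copyright (c) 2026 the pub-hodgecm-mathlib formalisation cell (harness21).  Prover seat hodgecm-mathlib-K2Liu-p08 (g4), Track B «K2-LIT» ∕ hLiu418
#184♮, socket #42S organ S1 (ROAD W), brick F7∕F8 (T3-frame (iii-c) sequel, (K3) continuity of the frame coordinate) (K2Liu-p01 (g8) 13:01:56Z ask
«`exists_frame_homeomorph` … concluding additionally `Continuous κ ∧ Continuous κ.symm`»).  2026-09-04.  KERNEL: theorems only.
-/
import Summits.HodgeConjecture.HodgeConjecture.Theorems.K2LiuWitnessFrameCoordinate    -- ★ p860223: `exists_frame_addEquiv` (K1)(K2), `vecMul_vecMul_nonsing_inv`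
import Mathlib.Topology.Instances.Matrix
import HarnessLib

/-!
# Crux `HLiu418`, #42S-S1 ROAD W, brick (T3-frame (iii-c), (K3)): THE FRAME COORDINATE `κ` IS A HOMEOMORPHISM

Cell `hodgecm-mathlib`, crux item hLiu418 = `stmt-HodgeConjecture-24832` (helper lane `--supports … --as helper`, count-neutral).  THEOREMS ONLY (no `def`, no instance,
no notation, no named-fact hypothesis, no `sorry`).  K2Liu-p01 (g8)'s ask 13:01:56Z: ★ κ-comp p860223 `exists_frame_addEquiv` gives the frame coordinate
`κ : Y ≃+ (Fin 2 → R)³` with (K1) «frame coordinates × frame = diagonal coordinates» and (K2) «Gram compatibility»; the top files (inert ∕ split) also need (K3): `κ` and `κ⁻¹`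
CONTINUOUS (so the pulled-back boxes `κ⁻¹(S_i²)` are compact open ⇒ `𝟙_{κ⁻¹S₁²} − 𝟙_{κ⁻¹S₂²} ∈ 𝒮` by ★ `indicator_mem_schwartzBruhat`, and ★ (J)'s `hQm`).  GENERIC over a
topological commutative ring `R` (:= `LocalRing L v`) and a topological `Y` (the Y-model), inputs BY VALUE `κ₀ : Y ≃+ (ι′ → R)` with `Continuous κ₀`, `Continuous κ₀.symm`
(★ (K3) p860389 `exists_continuousLinearEquiv`), `e`, `σ`, the frame `P` (`IsUnit P.det`, `P·Dᵀ·σ(P)ᵀ = M_hyp(d)`):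
* `kappa_apply_eq` ((K1) determines `κ`: `![(κ x).1 j, (κ x).2.1 j, (κ x).2.2 j] = (l ↦ κ₀ x (e (j,l))) ᵥ* P⁻¹`), `kappa0_symm_apply_eq` (and `κ.symm` through `κ₀.symm` and `ᵥ* P`),
  `continuous_vecCons_three` (bookkeeping), ★★ HEAD **`exists_frame_homeomorph`**: `∃ κ, (K1) ∧ (K2) ∧ Continuous κ ∧ Continuous κ.symm`.
[Shimura1997, §13.2] [Scharlau1985HermitianForms, Ch. 7 §1].
HONEST LABEL.  Count-neutral helper; `HC_CM` is proved only modulo the 7 printed citations (2 remaining named inputs: hLiu418 = `stmt-HodgeConjecture-24832`,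
h413 = `stmt-HodgeConjecture-24833`) until rung 0 closes.

## References
* [Shimura1997] G. Shimura, *Euler products and Eisenstein series*, CBMS 93 (1997), §13.2.
* [Scharlau1985HermitianForms] W. Scharlau, *Quadratic and Hermitian Forms*, Grundlehren 270 (1985), Ch. 7 §1.
-/

set_option autoImplicit false
set_option linter.dupNamespace false -- the mandated namespace repeats `HodgeConjecture.HodgeConjecture`

open Matrix

namespace Summit.HodgeConjecture.HodgeConjecture.Cruxes.HLiu418.K2LiuWitnessFrameCoordinateContinuous

open K2LiuWitnessFrameCoordinate

variable {R : Type*} [CommRing R] [TopologicalSpace R] [IsTopologicalRing R] {Y : Type*} [AddCommGroup Y] [TopologicalSpace Y] {ι' : Type*}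

omit [TopologicalSpace R] [IsTopologicalRing R] [TopologicalSpace Y] in
/-- (K1) DETERMINES `κ`: the `j`-th frame coordinate vector is `(l ↦ κ₀ x (e (j,l))) ᵥ* P⁻¹`. [cite: Scharlau1985HermitianForms, Ch. 7 §1] -/
theorem kappa_apply_eq (κ₀ : Y ≃+ (ι' → R)) (e : Fin 2 × Fin 3 ≃ ι') {P : Matrix (Fin 3) (Fin 3) R} (hPdet : IsUnit P.det)
    (κ : Y ≃+ (Fin 2 → R) × (Fin 2 → R) × (Fin 2 → R)) (h1 : ∀ x j, ![(κ x).1 j, (κ x).2.1 j, (κ x).2.2 j] ᵥ* P = fun l => κ₀ x (e (j, l))) (x : Y) (j : Fin 2) :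
    ![(κ x).1 j, (κ x).2.1 j, (κ x).2.2 j] = (fun l => κ₀ x (e (j, l))) ᵥ* P⁻¹ := by
  rw [← h1 x j, vecMul_vecMul_nonsing_inv hPdet]

omit [TopologicalSpace R] [IsTopologicalRing R] [TopologicalSpace Y] in
/-- … and `κ⁻¹` through `κ₀⁻¹`: `κ.symm t = κ₀.symm (i ↦ (![t.1 j, t.2.1 j, t.2.2 j] ᵥ* P) l)` with `(j, l) = e⁻¹ i`. [cite: Scharlau1985HermitianForms, Ch. 7 §1] -/
theorem kappa0_symm_apply_eq (κ₀ : Y ≃+ (ι' → R)) (e : Fin 2 × Fin 3 ≃ ι') {P : Matrix (Fin 3) (Fin 3) R}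
    (κ : Y ≃+ (Fin 2 → R) × (Fin 2 → R) × (Fin 2 → R)) (h1 : ∀ x j, ![(κ x).1 j, (κ x).2.1 j, (κ x).2.2 j] ᵥ* P = fun l => κ₀ x (e (j, l)))
    (t : (Fin 2 → R) × (Fin 2 → R) × (Fin 2 → R)) :
    κ.symm t = κ₀.symm (fun i => (![t.1 (e.symm i).1, t.2.1 (e.symm i).1, t.2.2 (e.symm i).1] ᵥ* P) (e.symm i).2) := by
  apply κ₀.injective
  rw [AddEquiv.apply_symm_apply]
  funext i
  have h := congrFun (h1 (κ.symm t) (e.symm i).1) (e.symm i).2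
  rw [AddEquiv.apply_symm_apply] at h
  rw [h]
  simp only [Prod.mk.eta, Equiv.apply_symm_apply]

omit [CommRing R] [IsTopologicalRing R] in
/-- the three-entry vector of continuous coordinates is continuous. [folklore] -/
theorem continuous_vecCons_three {Z : Type*} [TopologicalSpace Z] {a b c : Z → R} (ha : Continuous a) (hb : Continuous b) (hc : Continuous c) :
    Continuous fun z => ![a z, b z, c z] := by
  refine continuous_pi fun l => ?_
  fin_cases l
  · exact ha
  · exact hb
  · exact hc

/-- **THE FRAME COORDINATE IS A HOMEOMORPHISM** (HEAD; K2Liu-p01 (g8)'s `exists_frame_homeomorph`): with `κ₀` continuous both ways (★ (K3)), the `κ` of ★ `exists_frame_addEquiv`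
(same (K1), (K2)) is continuous and so is `κ⁻¹` — the later layers are `ᵥ* P⁻¹` ∕ `ᵥ* P`, reindexing and regrouping over the topological ring `R`.
[cite: Shimura1997, §13.2] [cite: Scharlau1985HermitianForms, Ch. 7 §1] -/
theorem exists_frame_homeomorph (κ₀ : Y ≃+ (ι' → R)) (hκ₀ : Continuous κ₀) (hκ₀' : Continuous κ₀.symm) (e : Fin 2 × Fin 3 ≃ ι') (σ : R →+* R)
    {D P : Matrix (Fin 3) (Fin 3) R} {d : R} (hPdet : IsUnit P.det) (hP : P * Dᵀ * (P.map σ)ᵀ = !![0, 1, 0; 1, 0, 0; 0, 0, d]) :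
    ∃ κ : Y ≃+ (Fin 2 → R) × (Fin 2 → R) × (Fin 2 → R),
      (∀ x j, ![(κ x).1 j, (κ x).2.1 j, (κ x).2.2 j] ᵥ* P = fun l => κ₀ x (e (j, l))) ∧
      (∀ x j i, (∑ k, ∑ l, κ₀ x (e (j, l)) * D k l * σ (κ₀ x (e (i, k)))) =
        (vecMulVec (κ x).1 (fun r => σ ((κ x).2.1 r)) + vecMulVec (κ x).2.1 (fun r => σ ((κ x).1 r)) + d • vecMulVec (κ x).2.2 (fun r => σ ((κ x).2.2 r))) j i) ∧
      Continuous κ ∧ Continuous κ.symm := by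
  obtain ⟨κ, h1, h2⟩ := exists_frame_addEquiv κ₀ e σ hPdet hP
  refine ⟨κ, h1, h2, ?_, ?_⟩
  · -- `κ x = (j ↦ F x j 0, j ↦ F x j 1, j ↦ F x j 2)`, `F x j := (l ↦ κ₀ x (e (j,l))) ᵥ* P⁻¹`
    have hF : ∀ j, Continuous fun x => (fun l => κ₀ x (e (j, l))) ᵥ* P⁻¹ := fun j =>
      Continuous.matrix_vecMul (continuous_pi fun l => (continuous_apply _).comp hκ₀) continuous_const
    have hcoord : ∀ (x : Y) (j : Fin 2) (l : Fin 3), ![(κ x).1 j, (κ x).2.1 j, (κ x).2.2 j] l = ((fun l => κ₀ x (e (j, l))) ᵥ* P⁻¹) l :=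
      fun x j l => congrFun (kappa_apply_eq κ₀ e hPdet κ h1 x j) l
    have hc : Continuous fun x => ((fun j => ((fun l => κ₀ x (e (j, l))) ᵥ* P⁻¹) 0, fun j => ((fun l => κ₀ x (e (j, l))) ᵥ* P⁻¹) 1,
        fun j => ((fun l => κ₀ x (e (j, l))) ᵥ* P⁻¹) 2) : (Fin 2 → R) × (Fin 2 → R) × (Fin 2 → R)) :=
      (continuous_pi fun j => (continuous_apply 0).comp (hF j)).prodMk
        ((continuous_pi fun j => (continuous_apply 1).comp (hF j)).prodMk (continuous_pi fun j => (continuous_apply 2).comp (hF j)))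
    refine hc.congr fun x => ?_
    refine Prod.ext (funext fun j => (hcoord x j 0).symm) (Prod.ext (funext fun j => (hcoord x j 1).symm) (funext fun j => (hcoord x j 2).symm))
  · -- `κ.symm t = κ₀.symm (G t)` with `G` built from `ᵥ* P`
    have hG : Continuous fun t : (Fin 2 → R) × (Fin 2 → R) × (Fin 2 → R) =>
        fun i => (![t.1 (e.symm i).1, t.2.1 (e.symm i).1, t.2.2 (e.symm i).1] ᵥ* P) (e.symm i).2 := by
      refine continuous_pi fun i => (continuous_apply _).comp (Continuous.matrix_vecMul ?_ continuous_const)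
      exact continuous_vecCons_three ((continuous_apply _).comp continuous_fst) ((continuous_apply _).comp (continuous_fst.comp continuous_snd))
        ((continuous_apply _).comp (continuous_snd.comp continuous_snd))
    refine (hκ₀'.comp hG).congr fun t => ?_
    exact (kappa0_symm_apply_eq κ₀ e κ h1 t).symm

end Summit.HodgeConjecture.HodgeConjecture.Cruxes.HLiu418.K2LiuWitnessFrameCoordinateContinuous
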